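import Literature.Geometry.Riemannian.UnwindingCollarData
import Mathlib.Analysis.Calculus.Deriv.MeanValue
import Mathlib.Analysis.SpecialFunctions.Sqrt
import HarnessLib

/-!
# The radial derivative of the collar cone map along rays: `∂_σ ‖C(σ N u)‖ ≥ 1 - κ`

Topic `Geometry/Riemannian`. Continuing `UnwindingCollarData.lean`. Along the ray of a unit vector
`u` the radial function `r_u(σ) = ‖C(σ N u)‖` of the collar cone map has derivative
`g(σ, u) = ⟪N(C(σ N u)), DC_{σ N u}(N u)⟫` (`hasDerivAt_norm_coneMap_ray`), continuous in `(σ, u)`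
(`continuousOn_radialDeriv`); under the normalisation `1 ≤ ⟪u, DC_u(u)⟫` on the unit sphere
(in the round picture of Weinstein's disk this is `⟪u, ν(u)⟫ = √q ≥ 1`, arranged by a global
rescaling) it stays `≥ 1 - κ` for `|σ - 1| ≤ ε₁` (`exists_forall_radialDeriv_ge`), whence the
one-sided estimate `(1 - κ)(σ' - σ) ≤ r_u(σ') - r_u(σ)` for `σ ≤ σ'`
(`mul_sub_le_norm_coneMap_ray_sub`) — the radial growth entering the shell lemma in the collar
zone of the interior surgery map (Weinstein 1968, proof of the main theorem, step (3)).

## References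

* A. Weinstein, Ann. of Math. (2) 87 (1968), 29–41. [cite: Weinstein1968]

Tags: [ConeMap] [Weinstein1968]
-/

noncomputable section

open Set Function Metric Filter
open scoped Topology RealInnerProductSpace

namespace Literature.Geometry.Riemannian

variable {V : Type*} [NormedAddCommGroup V] [InnerProductSpace ℝ V] [FiniteDimensional ℝ V]

omit [FiniteDimensional ℝ V] in
/-- **Derivative of the norm along a curve**: `d/dt ‖c t‖ = ⟪N(c t), c'(t)⟫` at points where
`c t ≠ 0`. [folklore] -/
theorem hasDerivAt_norm_comp {c : ℝ → V} {c' : V} {t : ℝ} (hc : HasDerivAt c c' t) (h0 : c t ≠ 0) :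
    HasDerivAt (fun s ↦ ‖c s‖) ⟪‖c t‖⁻¹ • c t, c'⟫ t := by
  have hn : 0 < ‖c t‖ := norm_pos_iff.2 h0
  have h1 : HasDerivAt (fun s ↦ ‖c s‖ ^ 2) (2 * ⟪c t, c'⟫) t := hc.norm_sq
  have h2 : HasDerivAt (fun s ↦ Real.sqrt (‖c s‖ ^ 2))
      (2 * ⟪c t, c'⟫ / (2 * Real.sqrt (‖c t‖ ^ 2))) t := h1.sqrt (by positivity)
  have hfun : (fun s ↦ Real.sqrt (‖c s‖ ^ 2)) = fun s ↦ ‖c s‖ := funext fun s ↦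
    Real.sqrt_sq (norm_nonneg _)
  rw [hfun, Real.sqrt_sq hn.le] at h2
  convert h2 using 1
  rw [inner_smul_left]
  simp only [map_inv₀, RCLike.conj_to_real]
  field_simp

omit [FiniteDimensional ℝ V] in
/-- **`d/dσ ‖C(σ N u)‖ = ⟪N(C(σ N u)), DC_{σ N u}(N u)⟫`** for `|σ - 1| < ε' < 1`, `u ≠ 0`, `C`
differentiable and nonvanishing on the annulus. [folklore] -/
theorem hasDerivAt_norm_coneMap_ray {C : V → V} {ε' : ℝ} (hε'1 : ε' < 1)
    (hC : DifferentiableOn ℝ C {v : V | 1 - ε' < ‖v‖ ∧ ‖v‖ < 1 + ε'})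
    (hC0 : ∀ v : V, 1 - ε' < ‖v‖ → ‖v‖ < 1 + ε' → C v ≠ 0) {σ : ℝ} (hσ : |σ - 1| < ε') {u : V}
    (hu : u ≠ 0) :
    HasDerivAt (fun s : ℝ ↦ ‖C (s • (‖u‖⁻¹ • u))‖)
      ⟪‖C (σ • (‖u‖⁻¹ • u))‖⁻¹ • C (σ • (‖u‖⁻¹ • u)),
        fderiv ℝ C (σ • (‖u‖⁻¹ • u)) (‖u‖⁻¹ • u)⟫ σ := by
  have hA : IsOpen {v : V | 1 - ε' < ‖v‖ ∧ ‖v‖ < 1 + ε'} :=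
    (isOpen_lt continuous_const continuous_norm).inter (isOpen_lt continuous_norm continuous_const)
  have hmem := smul_normalize_mem_annulus hσ hε'1 hu
  have hCd : HasFDerivAt C (fderiv ℝ C (σ • (‖u‖⁻¹ • u))) (σ • (‖u‖⁻¹ • u)) :=
    (hC.differentiableAt (hA.mem_nhds hmem)).hasFDerivAt
  have hray : HasDerivAt (fun s : ℝ ↦ s • (‖u‖⁻¹ • u)) (‖u‖⁻¹ • u) σ := by
    simpa using (hasDerivAt_id σ).smul_const (‖u‖⁻¹ • u)
  have hcomp := hCd.comp_hasDerivAt σ hray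
  exact hasDerivAt_norm_comp hcomp (hC0 _ hmem.1 hmem.2)

omit [FiniteDimensional ℝ V] in
/-- **The radial derivative is continuous** on `(1-ε', 1+ε') × (V ∖ {0})` for `C` of class `C¹`.
[folklore] -/
theorem continuousOn_radialDeriv {C : V → V} {ε' : ℝ} (hε'1 : ε' < 1)
    (hC : ContDiffOn ℝ 1 C {v : V | 1 - ε' < ‖v‖ ∧ ‖v‖ < 1 + ε'})
    (hC0 : ∀ v : V, 1 - ε' < ‖v‖ → ‖v‖ < 1 + ε' → C v ≠ 0) :
    ContinuousOn (fun q : ℝ × V ↦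
      ⟪‖C (q.1 • (‖q.2‖⁻¹ • q.2))‖⁻¹ • C (q.1 • (‖q.2‖⁻¹ • q.2)),
        fderiv ℝ C (q.1 • (‖q.2‖⁻¹ • q.2)) (‖q.2‖⁻¹ • q.2)⟫)
      (Ioo (1 - ε') (1 + ε') ×ˢ {u : V | u ≠ 0}) := by
  have hA : IsOpen {v : V | 1 - ε' < ‖v‖ ∧ ‖v‖ < 1 + ε'} :=
    (isOpen_lt continuous_const continuous_norm).inter (isOpen_lt continuous_norm continuous_const)
  have hfd : ContinuousOn (fderiv ℝ C) {v : V | 1 - ε' < ‖v‖ ∧ ‖v‖ < 1 + ε'} :=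
    hC.continuousOn_fderiv_of_isOpen hA le_rfl
  -- pointwise
  intro q hq
  obtain ⟨hσ, hu⟩ := hq
  have hu' : q.2 ≠ 0 := hu
  have hσ' : |q.1 - 1| < ε' := abs_lt.2 ⟨by linarith [hσ.1], by linarith [hσ.2]⟩
  have hmem := smul_normalize_mem_annulus hσ' hε'1 hu'
  have hN2 : ContinuousAt (fun q : ℝ × V ↦ ‖q.2‖⁻¹ • q.2) q :=
    ((contDiffAt_normalize (n := 0) hu').continuousAt).comp continuousAt_snd
  have hin : ContinuousAt (fun q : ℝ × V ↦ q.1 • (‖q.2‖⁻¹ • q.2)) q := continuousAt_fst.smul hN2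
  have hCat : ContinuousAt C (q.1 • (‖q.2‖⁻¹ • q.2)) :=
    (hC.continuousOn.continuousWithinAt hmem).continuousAt (hA.mem_nhds hmem)
  have hcomp : ContinuousAt (fun q : ℝ × V ↦ C (q.1 • (‖q.2‖⁻¹ • q.2))) q :=
    ContinuousAt.comp (f := fun q : ℝ × V ↦ q.1 • (‖q.2‖⁻¹ • q.2)) hCat hin
  have hNC : ContinuousAt ((fun y : V ↦ ‖y‖⁻¹ • y) ∘ fun q : ℝ × V ↦ C (q.1 • (‖q.2‖⁻¹ • q.2))) q :=
    ContinuousAt.comp (contDiffAt_normalize (n := 0) (hC0 _ hmem.1 hmem.2)).continuousAt hcomp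
  have hfdat : ContinuousAt (fderiv ℝ C) (q.1 • (‖q.2‖⁻¹ • q.2)) :=
    (hfd.continuousWithinAt hmem).continuousAt (hA.mem_nhds hmem)
  have hfdc : ContinuousAt (fun q : ℝ × V ↦ fderiv ℝ C (q.1 • (‖q.2‖⁻¹ • q.2))) q :=
    ContinuousAt.comp (f := fun q : ℝ × V ↦ q.1 • (‖q.2‖⁻¹ • q.2)) hfdat hin
  have happ : ContinuousAt (fun q : ℝ × V ↦ fderiv ℝ C (q.1 • (‖q.2‖⁻¹ • q.2)) (‖q.2‖⁻¹ • q.2)) q :=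
    hfdc.clm_apply hN2
  exact (hNC.inner happ).continuousWithinAt

/-- **`∂_σ ‖C(σ N u)‖ ≥ 1 - κ` near `σ = 1`** under the normalisation `1 ≤ ⟪u, DC_u(u)⟫` on the
unit sphere. [cite: Weinstein1968, proof of the main theorem, step (3)] -/
theorem exists_forall_radialDeriv_ge {C : V → V} {ε' : ℝ} (hε' : 0 < ε') (hε'1 : ε' < 1)
    (hC : ContDiffOn ℝ 1 C {v : V | 1 - ε' < ‖v‖ ∧ ‖v‖ < 1 + ε'})
    (hC0 : ∀ v : V, 1 - ε' < ‖v‖ → ‖v‖ < 1 + ε' → C v ≠ 0)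
    (hCid : ∀ u : V, ‖u‖ = 1 → C u = u) (hCtr : ∀ u : V, ‖u‖ = 1 → 1 ≤ ⟪u, fderiv ℝ C u u⟫)
    {κ : ℝ} (hκ : 0 < κ) :
    ∃ ε₁ : ℝ, 0 < ε₁ ∧ ε₁ < ε' ∧ ∀ σ : ℝ, |σ - 1| ≤ ε₁ → ∀ u : V, ‖u‖ = 1 →
      1 - κ ≤ ⟪‖C (σ • (‖u‖⁻¹ • u))‖⁻¹ • C (σ • (‖u‖⁻¹ • u)),
        fderiv ℝ C (σ • (‖u‖⁻¹ • u)) (‖u‖⁻¹ • u)⟫ := by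
  set g : ℝ × V → ℝ := fun q ↦ ⟪‖C (q.1 • (‖q.2‖⁻¹ • q.2))‖⁻¹ • C (q.1 • (‖q.2‖⁻¹ • q.2)),
    fderiv ℝ C (q.1 • (‖q.2‖⁻¹ • q.2)) (‖q.2‖⁻¹ • q.2)⟫ with hg
  have hgc : ContinuousOn g (Ioo (1 - ε') (1 + ε') ×ˢ {u : V | u ≠ 0}) :=
    continuousOn_radialDeriv hε'1 hC hC0
  -- `f(σ, u) = g(σ, u) - g(1, u)` on `[1 - ε'/2, 1 + ε'/2] × sphere`
  set f : ℝ × V → ℝ := fun q ↦ g q - g (1, q.2) with hf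
  have hsph0 : ∀ u ∈ Metric.sphere (0 : V) 1, u ≠ 0 := by
    intro u hu h0
    have hu1 : ‖u‖ = 1 := by simpa using hu
    rw [h0, norm_zero] at hu1; exact zero_ne_one hu1
  have hK : Icc (1 - ε' / 2) (1 + ε' / 2) ×ˢ Metric.sphere (0 : V) 1 ⊆
      Ioo (1 - ε') (1 + ε') ×ˢ {u : V | u ≠ 0} := by
    rintro ⟨σ, u⟩ ⟨hσ, hu⟩
    exact ⟨⟨by linarith [hσ.1], by linarith [hσ.2]⟩, hsph0 u hu⟩
  have hfc : ContinuousOn f (Icc (1 - ε' / 2) (1 + ε' / 2) ×ˢ Metric.sphere (0 : V) 1) := by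
    refine (hgc.mono hK).sub ?_
    have h2 : ContinuousOn (fun q : ℝ × V ↦ ((1 : ℝ), q.2))
        (Icc (1 - ε' / 2) (1 + ε' / 2) ×ˢ Metric.sphere (0 : V) 1) :=
      (continuous_const.prodMk continuous_snd).continuousOn
    refine hgc.comp h2 ?_
    rintro ⟨σ, u⟩ ⟨-, hu⟩
    exact ⟨⟨by linarith, by linarith⟩, hsph0 u hu⟩
  have hf0 : ∀ u ∈ Metric.sphere (0 : V) 1, f (1, u) = 0 := fun u _ ↦ by simp [hf]
  have hε2 : 0 < ε' / 2 := by linarith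
  obtain ⟨ε₁, hε₁, hε₁ε, hsmall⟩ :=
    exists_forall_norm_lt_near_one (isCompact_sphere (0 : V) 1) hε2 hfc hf0 hκ
  refine ⟨ε₁, hε₁, by linarith, fun σ hσ u hu ↦ ?_⟩
  have huS : u ∈ Metric.sphere (0 : V) 1 := by simpa using hu
  have h := hsmall σ hσ u huS
  rw [Real.norm_eq_abs, abs_lt] at h
  -- `g(1, u) ≥ 1`
  have hg1 : 1 ≤ g (1, u) := by
    simp only [hg, one_smul, hCid u hu, hu, inv_one]
    exact hCtr u hu
  simp only [hf] at h
  show 1 - κ ≤ g (σ, u)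
  linarith [h.1]

omit [FiniteDimensional ℝ V] in
/-- **Radial growth of the collar cone map**: with `1 - κ ≤ ∂_σ‖C(σ N u)‖` for `|σ - 1| ≤ ε₁`
(`ε₁ < ε' < 1`), `(1 - κ)(σ' - σ) ≤ ‖C(σ' N u)‖ - ‖C(σ N u)‖` for `1 - ε₁ ≤ σ ≤ σ' ≤ 1 + ε₁`.
[cite: Weinstein1968, proof of the main theorem, step (3)] -/
theorem mul_sub_le_norm_coneMap_ray_sub {C : V → V} {ε' ε₁ : ℝ} (hε₁ε : ε₁ < ε') (hε'1 : ε' < 1)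
    (hC : DifferentiableOn ℝ C {v : V | 1 - ε' < ‖v‖ ∧ ‖v‖ < 1 + ε'})
    (hC0 : ∀ v : V, 1 - ε' < ‖v‖ → ‖v‖ < 1 + ε' → C v ≠ 0) {κ : ℝ} {u : V} (hu : u ≠ 0)
    (hder : ∀ σ : ℝ, |σ - 1| ≤ ε₁ →
      1 - κ ≤ ⟪‖C (σ • (‖u‖⁻¹ • u))‖⁻¹ • C (σ • (‖u‖⁻¹ • u)),
        fderiv ℝ C (σ • (‖u‖⁻¹ • u)) (‖u‖⁻¹ • u)⟫)
    {σ σ' : ℝ} (hσ : 1 - ε₁ ≤ σ) (hσσ' : σ ≤ σ') (hσ' : σ' ≤ 1 + ε₁) :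
    (1 - κ) * (σ' - σ) ≤ ‖C (σ' • (‖u‖⁻¹ • u))‖ - ‖C (σ • (‖u‖⁻¹ • u))‖ := by
  set r : ℝ → ℝ := fun s ↦ ‖C (s • (‖u‖⁻¹ • u))‖ with hr
  have hderiv : ∀ s ∈ Icc (1 - ε₁) (1 + ε₁), HasDerivAt r
      ⟪‖C (s • (‖u‖⁻¹ • u))‖⁻¹ • C (s • (‖u‖⁻¹ • u)), fderiv ℝ C (s • (‖u‖⁻¹ • u)) (‖u‖⁻¹ • u)⟫
      s := fun s hs ↦
    hasDerivAt_norm_coneMap_ray hε'1 hC hC0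
      (abs_lt.2 ⟨by linarith [hs.1], by linarith [hs.2]⟩) hu
  have hconv : Convex ℝ (Icc (1 - ε₁) (1 + ε₁)) := convex_Icc _ _
  have hcont : ContinuousOn r (Icc (1 - ε₁) (1 + ε₁)) := fun s hs ↦
    (hderiv s hs).continuousAt.continuousWithinAt
  have hdiff : DifferentiableOn ℝ r (interior (Icc (1 - ε₁) (1 + ε₁))) := fun s hs ↦
    (hderiv s (interior_subset hs)).differentiableAt.differentiableWithinAt
  have hge : ∀ s ∈ interior (Icc (1 - ε₁) (1 + ε₁)), 1 - κ ≤ deriv r s := by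
    intro s hs
    have hs' := interior_subset hs
    rw [(hderiv s hs').deriv]
    exact hder s (abs_le.2 ⟨by linarith [hs'.1], by linarith [hs'.2]⟩)
  exact hconv.mul_sub_le_image_sub_of_le_deriv hcont hdiff hge σ ⟨hσ, hσσ'.trans hσ'⟩ σ'
    ⟨hσ.trans hσσ', hσ'⟩ hσσ'

end Literature.Geometry.Riemannian

end
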